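/-
Copyright (c) 2026 the pub-hodgecm-mathlib formalisation cell (harness21).  Prover seat hodgecm-mathlib-K2E5-p16 (g5): Track B «K2-LIT»,
hLiu418 = stmt-HodgeConjecture-24832, ROAD Φ organ Φ6b-6 (β-shift of Shimura's `η` on `Herm₂(ℂ)`), file (5): the β-shifted `Ξ` —
the continuation `Ξ(g, h; α, β)` of Shimura's `ξ` carried to `ℂ × {re β > 0}`, and its diagonal `Ξ(y, h; s + 3∕2, s + ½)` on `{re s > −½}`;
2026-09-04.
-/
import Summits.HodgeConjecture.HodgeConjecture.Theorems.K2LiuHermTwoEtaBetaShift            -- ★ p858438: `etaShift = (β−1)η`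
import Summits.HodgeConjecture.HodgeConjecture.Theorems.K2LiuHermTwoEtaShiftHolomorphy      -- 📤 p858462: `etaShift` along lines
import Summits.HodgeConjecture.HodgeConjecture.Theorems.K2LiuHermTwoXiContinuation          -- ★ p858155: `Ξ`, `ξ = Ξ` on `re α > 3`
import Summits.HodgeConjecture.HodgeConjecture.Theorems.K2LiuHermTwoXiZeroValue             -- ★ (h = 0 value): `posDef_two_smul`
import Mathlib.Analysis.SpecialFunctions.Gamma.Beta
import HarnessLib

/-!
# Crux `HLiu418`, ROAD Φ, organ Φ6b-6 — file (5): `Ξ` on `ℂ × {re β > 0}`; the arch diagonal `Ξ(y, h; s + 3∕2, s + ½)` on `{re s > −½}`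

Cell `hodgecm-mathlib`, crux item hLiu418 = `stmt-HodgeConjecture-24832`, route of record `HCCMUnconditional`; squad K2, LEAD F0P6-plan (g12)
(«= GO the first-order vehicle» 2026-09-04 07:40:27Z, rider (R2): the consumer face BY NAME + the agreement clause), co-dealer K2E5-plan (g6)
(rider (a): `differentiableOn_xiShift_affine` on an OPEN `U` with `0 < re(β₀ + v s)`, `xiShift_eq_xiEtaRhs`), prover K2E5-p16 (g5).
THEOREMS ONLY (no `def`, no instance, no notation, no named-fact hypothesis, no `sorry`); lane `--supports stmt-HodgeConjecture-24832 --as helper`.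

THE OBJECT.  `xiShift g h α β = 4π⁴ e^{iπ(β−α)} Γ₂(α)⁻¹ (π Γ(β)²)⁻¹ etaShift(2g, πh; α, β)` (★ DEFS `K2LiuHermTwoEtaShiftDefs`).
WHAT IS PROVED (`g, h > 0`).
* `sub_one_mul_hermTwoGamma` — `(β − 1)·Γ₂(β) = π Γ(β)²` (`β ≠ 1`; `Γ₂(β) = π Γ(β) Γ(β−1)`).
* `xiShift_eq_xiEtaRhs (hβ : 1 < re β)` — THE AGREEMENT CLAUSE: `xiShift g h α β = 4π⁴ e^{iπ(β−α)} Γ₂(α)⁻¹ Γ₂(β)⁻¹ η(2g, πh; α, β)`, i.e. `xiShift`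
  IS the continuation `Ξ` of ★ `xiTwo_continuation_explicit` wherever the latter is defined; `xiShift_eq_xiTwo (hα : 3 < re α) (hβ : 1 < re β)` —
  and hence Shimura's `ξ(g, h; α, β)` itself on the domain of ★ `xiTwo_eq_etaTwo`.
* `differentiableOn_xiShift_affine (hU0 : ∀ s ∈ U, 0 < re(β₀ + v s))` — `s ↦ xiShift g h (α₀ + u s) (β₀ + v s)` is holomorphic on every such `U`
  (★ `differentiableOn_etaShift_affine`, `Γ₂(α)⁻¹` and `Γ(β)⁻¹` entire): `Ξ` LIVES ON `ℂ × {re β > 0}`, one unit left of ★ `differentiableOn_xiEta_affine`.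
* `differentiableOn_xiShift_diag`, and THE ARCH COEFFICIENT OF #41: `differentiableOn_xiShift_archDiag` — `s ↦ xiShift g h (s + 3∕2) (s + 1∕2)` is
  holomorphic on `{s | −1∕2 < re s}` ⊃ `{0 < re s}` ∋ `s₀ = ½` (where `β = 1` sits ON the old abscissa `re β > 1`).
HONEST LABEL.  Count-neutral helper of the K2_Liu road; it pays no socket by itself: `HC_CM` is proved only modulo the 7 printed citations
(2 remaining named inputs: hLiu418 = `stmt-HodgeConjecture-24832`, h413 = `stmt-HodgeConjecture-24833`) until rung 0 closes.
-/

set_option autoImplicit false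
-- the mandated namespace repeats the single-problem summit's segment (`HodgeConjecture.HodgeConjecture`)
set_option linter.dupNamespace false

noncomputable section

open Complex MeasureTheory Set
open scoped ComplexOrder ComplexConjugate

namespace Summit.HodgeConjecture.HodgeConjecture.Cruxes.HLiu418.K2LiuHermTwoXiBetaShift

open Summit.HodgeConjecture.HodgeConjecture.Cruxes.HLiu418.K2LiuHermTwoGammaDefs
open Summit.HodgeConjecture.HodgeConjecture.Cruxes.HLiu418.K2LiuHermTwoConfluentXiDefs
open Summit.HodgeConjecture.HodgeConjecture.Cruxes.HLiu418.K2LiuHermTwoEtaDefs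
open Summit.HodgeConjecture.HodgeConjecture.Cruxes.HLiu418.K2LiuHermTwoEtaHolomorphy
open Summit.HodgeConjecture.HodgeConjecture.Cruxes.HLiu418.K2LiuHermTwoXiEtaIdentity
open Summit.HodgeConjecture.HodgeConjecture.Cruxes.HLiu418.K2LiuHermTwoXiZeroValue
open Summit.HodgeConjecture.HodgeConjecture.Cruxes.HLiu418.K2LiuHermTwoEtaShiftDefs
open Summit.HodgeConjecture.HodgeConjecture.Cruxes.HLiu418.K2LiuHermTwoEtaBetaShift
open Summit.HodgeConjecture.HodgeConjecture.Cruxes.HLiu418.K2LiuHermTwoEtaShiftHolomorphy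

/-! ## `(β − 1) Γ₂(β) = π Γ(β)²` -/

/-- `(β − 1)·Γ₂(β) = π·Γ(β)²` for `β ≠ 1` (`Γ₂(β) = π Γ(β) Γ(β−1)` and `Γ(β) = (β − 1)Γ(β − 1)`). -/
theorem sub_one_mul_hermTwoGamma {β : ℂ} (hβ : β ≠ 1) : (β - 1) * hermTwoGamma β = (Real.pi : ℂ) * Complex.Gamma β ^ 2 := by
  have h := Complex.Gamma_add_one (β - 1) (sub_ne_zero.mpr hβ)
  rw [sub_add_cancel] at h
  rw [hermTwoGamma_def, sq]
  calc (β - 1) * ((Real.pi : ℂ) * Complex.Gamma β * Complex.Gamma (β - 1))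
      = (Real.pi : ℂ) * Complex.Gamma β * ((β - 1) * Complex.Gamma (β - 1)) := by ring
    _ = (Real.pi : ℂ) * (Complex.Gamma β * Complex.Gamma β) := by rw [← h]; ring

/-- On `re β > 1`: `(π Γ(β)²)⁻¹ · (β − 1) = Γ₂(β)⁻¹`. -/
theorem inv_pi_Gamma_sq_mul_sub_one {β : ℂ} (hβ : 1 < β.re) :
    ((Real.pi : ℂ) * Complex.Gamma β ^ 2)⁻¹ * (β - 1) = (hermTwoGamma β)⁻¹ := by
  have hβ1 : β ≠ 1 := by
    intro h
    rw [h, one_re] at hβ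
    exact lt_irrefl _ hβ
  have hΓ : hermTwoGamma β ≠ 0 := hermTwoGamma_ne_zero hβ
  have hπΓ : (Real.pi : ℂ) * Complex.Gamma β ^ 2 ≠ 0 := by
    rw [← sub_one_mul_hermTwoGamma hβ1]
    exact mul_ne_zero (sub_ne_zero.mpr hβ1) hΓ
  have hb : β - 1 ≠ 0 := sub_ne_zero.mpr hβ1
  rw [← sub_one_mul_hermTwoGamma hβ1, mul_inv]
  field_simp

/-! ## The agreement clause: `xiShift = Ξ` on `re β > 1` -/

/-- `πh > 0` for `h > 0`. -/
theorem posDef_pi_smul {h : Matrix (Fin 2) (Fin 2) ℂ} (hh : h.PosDef) : ((Real.pi : ℂ) • h).PosDef := by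
  obtain ⟨e, rfl⟩ : ∃ e : ℝ × ℂ × ℝ, hermTwo e = h := ⟨_, hermTwo_eq_of_isHermitian hh.1⟩
  rw [← hermTwo_smul]
  exact posDef_hermTwo_smul Real.pi_pos hh

/-- **THE AGREEMENT CLAUSE** (LEAD rider (R2), co-dealer rider (a)): for `g, h > 0`, every `α` and `re β > 1`,
`xiShift g h α β = 4π⁴ · e^{iπ(β−α)} · Γ₂(α)⁻¹ · Γ₂(β)⁻¹ · η(2g, πh; α, β)` — the β-shifted `Ξ` IS the continuation `Ξ` of ★
`xiTwo_continuation_explicit` (not a cousin) wherever the latter is defined. -/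
theorem xiShift_eq_xiEtaRhs {g h : Matrix (Fin 2) (Fin 2) ℂ} (hg : g.PosDef) (hh : h.PosDef) (α : ℂ) {β : ℂ} (hβ : 1 < β.re) :
    xiShift g h α β = ((4 * Real.pi ^ 4 : ℝ) : ℂ) * cexp ((Real.pi * I) * (β - α)) * (hermTwoGamma α)⁻¹ * (hermTwoGamma β)⁻¹ *
      etaTwo ((2 : ℂ) • g) ((Real.pi : ℂ) • h) α β := by
  rw [xiShift_def, etaShift_eq_mul_etaTwo (posDef_two_smul hg) (posDef_pi_smul hh) α hβ, ← inv_pi_Gamma_sq_mul_sub_one hβ]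
  ring

/-- … and hence Shimura's `ξ` itself: `xiShift g h α β = ξ(g, h; α, β)` for `re α > 3`, `re β > 1` (★ `xiTwo_eq_etaTwo`). -/
theorem xiShift_eq_xiTwo {g h : Matrix (Fin 2) (Fin 2) ℂ} (hg : g.PosDef) (hh : h.PosDef) {α β : ℂ} (hα : 3 < α.re) (hβ : 1 < β.re) :
    xiShift g h α β = xiTwo g h α β := by
  rw [xiShift_eq_xiEtaRhs hg hh α hβ, xiTwo_eq_etaTwo hg hh hα hβ]

/-! ## Holomorphy of `xiShift` along complex lines in `ℂ × {re β > 0}` -/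

/-- `β ↦ (π Γ(β)²)⁻¹` is entire. -/
theorem differentiable_inv_pi_Gamma_sq : Differentiable ℂ (fun β : ℂ => ((Real.pi : ℂ) * Complex.Gamma β ^ 2)⁻¹) := by
  have h : (fun β : ℂ => ((Real.pi : ℂ) * Complex.Gamma β ^ 2)⁻¹) = fun β => (Real.pi : ℂ)⁻¹ * ((Complex.Gamma β)⁻¹) ^ 2 := by
    funext β
    rw [mul_inv, inv_pow]
  rw [h]
  exact (differentiable_const _).mul (Complex.differentiable_one_div_Gamma.pow 2)

/-- **`Ξ` ON `ℂ × {re β > 0}`** (co-dealer rider (a), BY NAME): for `g, h > 0`, `α₀ β₀ u v : ℂ` and every `U ⊆ {s | 0 < re(β₀ + v s)}`,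
`s ↦ xiShift g h (α₀ + u s) (β₀ + v s)` is complex-differentiable on `U` — one unit LEFT of ★ `differentiableOn_xiEta_affine`. -/
theorem differentiableOn_xiShift_affine {g h : Matrix (Fin 2) (Fin 2) ℂ} (hg : g.PosDef) (hh : h.PosDef) (α₀ β₀ u v : ℂ) {U : Set ℂ}
    (hU0 : ∀ s ∈ U, 0 < (β₀ + v * s).re) :
    DifferentiableOn ℂ (fun s : ℂ => xiShift g h (α₀ + u * s) (β₀ + v * s)) U := by
  have hα : Differentiable ℂ (fun s : ℂ => α₀ + u * s) := (differentiable_id.const_mul u).const_add α₀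
  have hβ : Differentiable ℂ (fun s : ℂ => β₀ + v * s) := (differentiable_id.const_mul v).const_add β₀
  have hexp : Differentiable ℂ (fun s : ℂ => cexp ((Real.pi * I) * ((β₀ + v * s) - (α₀ + u * s)))) := ((hβ.sub hα).const_mul _).cexp
  have hΓα : Differentiable ℂ (fun s : ℂ => (hermTwoGamma (α₀ + u * s))⁻¹) := differentiable_hermTwoGamma_inv.comp hα
  have hΓβ : Differentiable ℂ (fun s : ℂ => ((Real.pi : ℂ) * Complex.Gamma (β₀ + v * s) ^ 2)⁻¹) := differentiable_inv_pi_Gamma_sq.comp hβ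
  have hη := differentiableOn_etaShift_affine_of_subset (posDef_two_smul hg) (posDef_pi_smul hh) α₀ β₀ u v hU0
  simp only [xiShift_def]
  exact (((((differentiable_const _).mul hexp).mul hΓα).mul hΓβ).differentiableOn).mul hη

/-- The same on the whole natural domain `{s | 0 < re(β₀ + v s)}`. -/
theorem differentiableOn_xiShift_affine' {g h : Matrix (Fin 2) (Fin 2) ℂ} (hg : g.PosDef) (hh : h.PosDef) (α₀ β₀ u v : ℂ) :
    DifferentiableOn ℂ (fun s : ℂ => xiShift g h (α₀ + u * s) (β₀ + v * s)) {s : ℂ | 0 < (β₀ + v * s).re} :=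
  differentiableOn_xiShift_affine hg hh α₀ β₀ u v fun _ hs => hs

/-- THE DIAGONAL: `s ↦ xiShift g h (a + s) (b + s)` is holomorphic on `{s | 0 < re(b + s)}` (`g, h > 0`). -/
theorem differentiableOn_xiShift_diag {g h : Matrix (Fin 2) (Fin 2) ℂ} (hg : g.PosDef) (hh : h.PosDef) (a b : ℂ) :
    DifferentiableOn ℂ (fun s : ℂ => xiShift g h (a + s) (b + s)) {s : ℂ | 0 < (b + s).re} := by
  have h := differentiableOn_xiShift_affine' hg hh a b 1 1
  simp only [one_mul] at h
  exact h

/-- **THE ARCHIMEDEAN COEFFICIENT OF #41 AT `det β ≠ 0`** (head (R3) of the deal): for `g, h > 0`, the diagonal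
`s ↦ Ξ(g, h; s + 3∕2, s + ½) = xiShift g h (s + 3∕2) (s + 1∕2)` is holomorphic on `{s | −1∕2 < re s}` — which contains `{0 < re s}` and the
centre `s₀ = ½` (where `β = 1` sits ON the abscissa `re β > 1` of the unshifted `Ξ`). -/
theorem differentiableOn_xiShift_archDiag {g h : Matrix (Fin 2) (Fin 2) ℂ} (hg : g.PosDef) (hh : h.PosDef) :
    DifferentiableOn ℂ (fun s : ℂ => xiShift g h (s + 3 / 2) (s + 1 / 2)) {s : ℂ | -(1 / 2 : ℝ) < s.re} := by
  have h := differentiableOn_xiShift_diag hg hh (3 / 2) (1 / 2)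
  have hset : {s : ℂ | 0 < ((1 / 2 : ℂ) + s).re} = {s : ℂ | -(1 / 2 : ℝ) < s.re} := by
    ext s
    simp only [Set.mem_setOf_eq, add_re]
    norm_num
    constructor <;> intro hs <;> linarith
  rw [hset] at h
  refine h.congr fun s _ => ?_
  rw [add_comm s (3 / 2), add_comm s (1 / 2)]

/-- On the old domain the arch diagonal is the unshifted one: for `re s > ½`,
`xiShift g h (s + 3∕2) (s + ½) = 4π⁴ e^{−iπ} Γ₂(s + 3∕2)⁻¹ Γ₂(s + ½)⁻¹ η(2g, πh; s + 3∕2, s + ½)`. -/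
theorem xiShift_archDiag_eq {g h : Matrix (Fin 2) (Fin 2) ℂ} (hg : g.PosDef) (hh : h.PosDef) {s : ℂ} (hs : 1 / 2 < s.re) :
    xiShift g h (s + 3 / 2) (s + 1 / 2) = ((4 * Real.pi ^ 4 : ℝ) : ℂ) * cexp ((Real.pi * I) * ((s + 1 / 2) - (s + 3 / 2))) *
      (hermTwoGamma (s + 3 / 2))⁻¹ * (hermTwoGamma (s + 1 / 2))⁻¹ * etaTwo ((2 : ℂ) • g) ((Real.pi : ℂ) • h) (s + 3 / 2) (s + 1 / 2) := by
  refine xiShift_eq_xiEtaRhs hg hh _ ?_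
  simp only [add_re]
  norm_num
  linarith

end Summit.HodgeConjecture.HodgeConjecture.Cruxes.HLiu418.K2LiuHermTwoXiBetaShift

end
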